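import Mathlib.MeasureTheory.Constructions.BorelSpace.Metric
import Mathlib.Topology.Algebra.MvPolynomial
import Mathlib.Analysis.Convex.PathConnected
import Mathlib.Analysis.SpecificLimits.Basic
import Mathlib.Data.Fintype.Pi
import Mathlib.Algebra.BigOperators.Fin
import Literature.MeasureTheory.Lebesgue.PolynomialZeroSet
import Literature.ModelTheory.ExponentialFields.TarskiSeidenbergProofs
import HarnessLib

/-!
# Volumes of semialgebraic sets: null boundaries (support file for Yoshinaga's theorem)

Parts A–B of the tree's proof that the volume of a bounded `ℚ`-semialgebraic set is a computable
real number — M. Yoshinaga, *Periods and elementary real numbers*, arXiv:0805.0349 (2008), §§3.3–3.6,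
in the weakened form "computable" instead of "elementary" (the target being the tree facts
`Literature.NumberTheory.Transcendental.isComputableReal_of_isRealPeriod` /
`isComputableComplex_of_isPeriod`, Yoshinaga's Theorem 18 in computable form).

* **Part A (null boundaries).** The frontier of a `k`-semialgebraic subset of `ℝᵐ` is
  Lebesgue-null (`volume_frontier_eq_zero_of_isSemialgebraic`): writing the set by sign conditions
  on a finite family of polynomials (`IsSemialgebraic.exists_eq_setOf_signVec_mem`), the signs are
  locally constant off the zero sets of the members not vanishing identically, so the frontier lies
  in finitely many zero sets of nonzero polynomials, null by the tree's
  `MvPolynomial.volume_zeroSet_eq_zero` [Caron–Traynor 2005]. This replaces, for mere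
  computability, the Minkowski-content estimate of Yoshinaga's §3.5–3.6 (Prop. 28, Lemma 29), which
  gives a *rate*.
* **Part B (Riemann sums by dyadic cubes, Yoshinaga §3.4).** Closed dyadic cubes `closedCube j k`
  of level `j` (side `2⁻ʲ`), indexed by codes `K < Lᵐ` through base-`L` digits (`digits`); the
  inner count `innerIdx` (cubes contained in `s`, Yoshinaga's `V_n`) and outer count `outerIdx`
  (cubes meeting `s`) satisfy `#inner · 2^{-jm} ≤ vol s ≤ #outer · 2^{-jm}` (the latter for
  `s ⊆ [0, L 2⁻ʲ)ᵐ`), and `(#outer - #inner) · 2^{-jm} ≤ vol(cthickening_{2⁻ʲ}(∂s)) → vol(∂s) = 0`,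
  the cubes counted in the difference being connected sets meeting `s` and `sᶜ`, hence `∂s`.

Parts C–D (primitive recursiveness of the counts via Tarski–Seidenberg, and the computable real)
are in `SemialgebraicVolumeComputable.lean`.

## References

* M. Yoshinaga, *Periods and elementary real numbers*, arXiv:0805.0349 (2008), §3.4 (Riemann sums
  `vol(V_n)`), Lemma 26, §3.6 (Lemma 29).
* R. Caron, T. Traynor, *The zero set of a polynomial*, WSMR Report 05-02 (2005).
-/

noncomputable section

open MeasureTheory Set MvPolynomial Filter Topology

namespace Literature.NumberTheory.Transcendental

/-! ### Zero sets and frontiers of semialgebraic sets are Lebesgue-null -/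

/-- The zero set of a polynomial with coefficients in `k` whose image in `ℝ[X₁,…,Xₘ]` is nonzero has
Lebesgue measure zero (the tree's `MvPolynomial.volume_zeroSet_eq_zero` for real coefficients).
[cite: CaronTraynor2005, Theorem (p. 1)] -/
theorem volume_setOf_aeval_eq_zero {k : Type*} [CommRing k] [Algebra k ℝ] {m : ℕ}
    (q : MvPolynomial (Fin m) k) (hq : map (algebraMap k ℝ) q ≠ 0) :
    volume {x : Fin m → ℝ | aeval x q = 0} = 0 := by
  have h : {x : Fin m → ℝ | aeval x q = 0} = {x | eval x (map (algebraMap k ℝ) q) = 0} := by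
    ext x
    rw [mem_setOf_eq, mem_setOf_eq, eval_map, aeval_def]
  rw [h]
  exact MvPolynomial.volume_zeroSet_eq_zero m _ hq

/-! ### The frontier of a semialgebraic set is Lebesgue-null -/

/-- Polynomial functions with coefficients in `k` are continuous on `ℝᵐ`. [folklore] -/
theorem continuous_aeval_of_algebra {k : Type*} [CommRing k] [Algebra k ℝ] {ι : Type*}
    (q : MvPolynomial ι k) : Continuous fun x : ι → ℝ => aeval x q := by
  have h : (fun x : ι → ℝ => aeval x q) = fun x => eval x (map (algebraMap k ℝ) q) := by
    funext x; rw [eval_map, aeval_def]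
  rw [h]
  exact MvPolynomial.continuous_eval _

/-- The sign of a polynomial is locally constant off its zero set, and constant if the
polynomial function vanishes identically. [folklore] -/
theorem eventually_sign_aeval_eq {k : Type*} [CommRing k] [Algebra k ℝ] {m : ℕ}
    (q : MvPolynomial (Fin m) k) (x : Fin m → ℝ)
    (hx : map (algebraMap k ℝ) q = 0 ∨ aeval x q ≠ 0) :
    ∀ᶠ y in 𝓝 x, SignType.sign (aeval y q) = SignType.sign (aeval x q) := by
  rcases hx with h0 | hne
  · have hzero : ∀ y : Fin m → ℝ, aeval y q = 0 := fun y => by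
      rw [aeval_def, ← eval_map, h0, map_zero]
    exact Eventually.of_forall fun y => by rw [hzero y, hzero x]
  · have hcont : ContinuousAt (fun y : Fin m → ℝ => aeval y q) x :=
      (continuous_aeval_of_algebra q).continuousAt
    rcases lt_or_gt_of_ne hne with hlt | hgt
    · filter_upwards [hcont.eventually (gt_mem_nhds hlt)] with y hy
      rw [sign_neg hy, sign_neg hlt]
    · filter_upwards [hcont.eventually (lt_mem_nhds hgt)] with y hy
      rw [sign_pos hy, sign_pos hgt]

/-- **The frontier of a semialgebraic set is Lebesgue-null.** Writing the set by simultaneous sign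
conditions on a finite family `Q` of polynomials, a point outside the zero sets of the members of
`Q` that do not vanish identically has a neighbourhood on which all the signs are constant, hence
lies in the interior of the set or of its complement; so the frontier is contained in a finite union
of zero sets of nonzero polynomials. [folklore] -/
theorem volume_frontier_eq_zero_of_isSemialgebraic {k : Type*} [CommRing k] [Algebra k ℝ] {m : ℕ}
    {s : Set (Fin m → ℝ)} (hs : Literature.ModelTheory.ExponentialFields.IsSemialgebraic k s) :
    volume (frontier s) = 0 := by
  classical
  obtain ⟨Q, T, rfl⟩ := hs.exists_eq_setOf_signVec_mem
  set N : Set (Fin m → ℝ) :=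
    ⋃ q ∈ Q, {x | map (algebraMap k ℝ) q ≠ 0 ∧ aeval x q = 0} with hN
  have hN0 : volume N = 0 := by
    rw [hN]
    refine (measure_biUnion_null_iff Q.countable_toSet).2 fun q _ => ?_
    by_cases hq : map (algebraMap k ℝ) q = 0
    · have : {x : Fin m → ℝ | map (algebraMap k ℝ) q ≠ 0 ∧ aeval x q = 0} = ∅ := by
        ext x; simp [hq]
      rw [this, measure_empty]
    · refine measure_mono_null (fun x hx => ?_) (volume_setOf_aeval_eq_zero q hq)
      exact hx.2
  refine measure_mono_null (fun x hx => ?_) hN0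
  by_contra hxN
  -- all signs are locally constant at `x`
  have hloc : ∀ᶠ y in 𝓝 x,
      (fun q : Q => SignType.sign (aeval y (q : MvPolynomial (Fin m) k))) =
        fun q : Q => SignType.sign (aeval x (q : MvPolynomial (Fin m) k)) := by
    have hall : ∀ q ∈ Q, ∀ᶠ y in 𝓝 x, SignType.sign (aeval y q) = SignType.sign (aeval x q) := by
      intro q hq
      refine eventually_sign_aeval_eq q x ?_
      by_contra hcon
      rw [not_or, not_ne_iff] at hcon
      exact hxN (mem_iUnion₂.2 ⟨q, hq, hcon.1, hcon.2⟩)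
    filter_upwards [(eventually_all_finset Q).2 hall] with y hy
    funext q
    exact hy q q.2
  set s : Set (Fin m → ℝ) :=
    {x | (fun q : Q => SignType.sign (aeval x (q : MvPolynomial (Fin m) k))) ∈ T} with hs'
  by_cases hxs : x ∈ s
  · apply hx.2
    rw [mem_interior_iff_mem_nhds]
    filter_upwards [hloc] with y hy
    show (fun q : Q => SignType.sign (aeval y (q : MvPolynomial (Fin m) k))) ∈ T
    rw [hy]; exact hxs
  · have hint : x ∈ interior sᶜ := by
      rw [mem_interior_iff_mem_nhds]
      filter_upwards [hloc] with y hy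
      show (fun q : Q => SignType.sign (aeval y (q : MvPolynomial (Fin m) k))) ∉ T
      rw [hy]; exact hxs
    rw [interior_compl] at hint
    exact hint hx.1


/-! ### A connected set meeting a set and its complement meets its frontier -/

/-- A preconnected set containing a point of `s` and a point outside `s` meets the frontier of `s`
(otherwise `interior s` and `interior sᶜ` would disconnect it). [folklore] -/
theorem exists_mem_frontier_of_isPreconnected {X : Type*} [TopologicalSpace X] {C s : Set X}
    (hC : IsPreconnected C) {a b : X} (ha : a ∈ C) (has : a ∈ s) (hb : b ∈ C) (hbs : b ∉ s) :
    ∃ z ∈ C, z ∈ frontier s := by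
  by_contra h
  rw [not_exists] at h
  have h' : ∀ z ∈ C, z ∉ frontier s := fun z hz hzf => h z ⟨hz, hzf⟩
  have hcover : C ⊆ interior s ∪ interior sᶜ := by
    intro z hz
    by_cases hzc : z ∈ closure s
    · left
      by_contra hzi
      exact h' z hz ⟨hzc, hzi⟩
    · right
      rw [interior_compl]
      exact hzc
  have ha' : a ∈ interior s := by
    rcases hcover ha with h1 | h1
    · exact h1
    · exact absurd has (interior_subset h1)
  have hb' : b ∈ interior sᶜ := by
    rcases hcover hb with h1 | h1
    · exact absurd (interior_subset h1) hbs
    · exact h1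
  obtain ⟨z, _, hz1, hz2⟩ :=
    hC _ _ isOpen_interior isOpen_interior hcover ⟨a, ha, ha'⟩ ⟨b, hb, hb'⟩
  rw [interior_compl] at hz2
  exact hz2 (interior_subset_closure hz1)

/-! ### Dyadic cubes and the inner and outer cube counts -/

section Cubes

variable {m : ℕ}

/-- Lower corner `k / 2ʲ` of the dyadic cube of level `j` with index `k ∈ ℕᵐ`. [folklore] -/
def cubeLo (j : ℕ) (k : Fin m → ℕ) : Fin m → ℝ := fun i => (k i : ℝ) / 2 ^ j

/-- Upper corner `(k + 1) / 2ʲ` of the dyadic cube of level `j` with index `k ∈ ℕᵐ`. [folklore] -/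
def cubeHi (j : ℕ) (k : Fin m → ℕ) : Fin m → ℝ := fun i => ((k i : ℝ) + 1) / 2 ^ j

/-- Side length of a dyadic cube of level `j` is `2⁻ʲ`. [folklore] -/
theorem cubeHi_sub_cubeLo (j : ℕ) (k : Fin m → ℕ) (i : Fin m) :
    cubeHi j k i - cubeLo j k i = 1 / 2 ^ j := by
  simp only [cubeHi, cubeLo]
  ring

/-- The lower corner is below the upper corner. [folklore] -/
theorem cubeLo_le_cubeHi (j : ℕ) (k : Fin m → ℕ) : cubeLo j k ≤ cubeHi j k := by
  intro i
  have h := cubeHi_sub_cubeLo j k i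
  have hpos : (0 : ℝ) < 1 / 2 ^ j := by positivity
  linarith

/-- The closed dyadic cube `∏ᵢ [kᵢ/2ʲ, (kᵢ+1)/2ʲ]` (Yoshinaga's `C_n(k₁,…,k_ℓ)` with `r = 1`,
`n = 2ʲ`). [cite: Yoshinaga2008, §3.4] -/
def closedCube (j : ℕ) (k : Fin m → ℕ) : Set (Fin m → ℝ) := Icc (cubeLo j k) (cubeHi j k)

/-- The half-open dyadic cube `∏ᵢ [kᵢ/2ʲ, (kᵢ+1)/2ʲ)`; these tile space. [folklore] -/
def hoCube (j : ℕ) (k : Fin m → ℕ) : Set (Fin m → ℝ) :=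
  Set.pi univ fun i => Ico (cubeLo j k i) (cubeHi j k i)

/-- The half-open cube lies in the closed cube. [folklore] -/
theorem hoCube_subset_closedCube (j : ℕ) (k : Fin m → ℕ) : hoCube j k ⊆ closedCube j k := by
  intro x hx
  rw [closedCube, ← pi_univ_Icc]
  exact fun i hi => Ico_subset_Icc_self (hx i hi)

/-- Half-open cubes are measurable. [folklore] -/
theorem measurableSet_hoCube (j : ℕ) (k : Fin m → ℕ) : MeasurableSet (hoCube j k) :=
  MeasurableSet.univ_pi fun _ => measurableSet_Ico

/-- The volume of a dyadic cube of level `j` in `ℝᵐ` is `2^{-jm}`. [folklore] -/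
theorem volume_hoCube (j : ℕ) (k : Fin m → ℕ) :
    volume (hoCube j k) = ENNReal.ofReal ((1 / 2 ^ j) ^ m) := by
  rw [hoCube, Real.volume_pi_Ico]
  simp_rw [cubeHi_sub_cubeLo]
  rw [Finset.prod_const, Finset.card_univ, Fintype.card_fin, ENNReal.ofReal_pow (by positivity)]

/-- A point lies in at most one half-open cube of a given level. [folklore] -/
theorem eq_of_mem_hoCube {j : ℕ} {k k' : Fin m → ℕ} {x : Fin m → ℝ} (hx : x ∈ hoCube j k)
    (hx' : x ∈ hoCube j k') : k = k' := by
  funext i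
  have h1 := hx i (mem_univ i)
  have h2 := hx' i (mem_univ i)
  simp only [cubeLo, cubeHi, mem_Ico] at h1 h2
  have hpos : (0 : ℝ) < 2 ^ j := by positivity
  rw [div_le_iff₀ hpos, lt_div_iff₀ hpos] at h1 h2
  have a1 : (k i : ℝ) < k' i + 1 := by linarith
  have a2 : (k' i : ℝ) < k i + 1 := by linarith
  have b1 : k i < k' i + 1 := by exact_mod_cast a1
  have b2 : k' i < k i + 1 := by exact_mod_cast a2
  omega

/-- The half-open cubes of a given level are pairwise disjoint. [folklore] -/
theorem pairwiseDisjoint_hoCube (j : ℕ) (S : Set (Fin m → ℕ)) : S.PairwiseDisjoint (hoCube j) := by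
  intro k _ k' _ hne
  rw [Function.onFun, Set.disjoint_left]
  intro x hx hx'
  exact hne (eq_of_mem_hoCube hx hx')

/-- A point of the nonnegative orthant lies in the half-open cube indexed by `⌊2ʲ x⌋`. [folklore] -/
theorem mem_hoCube_floor {j : ℕ} {x : Fin m → ℝ} (hx : ∀ i, 0 ≤ x i) :
    x ∈ hoCube j (fun i => ⌊x i * 2 ^ j⌋₊) := by
  intro i _
  have hpos : (0 : ℝ) < 2 ^ j := by positivity
  have h0 : 0 ≤ x i * 2 ^ j := mul_nonneg (hx i) hpos.le
  simp only [cubeLo, cubeHi, mem_Ico]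
  rw [div_le_iff₀ hpos, lt_div_iff₀ hpos]
  exact ⟨Nat.floor_le h0, Nat.lt_floor_add_one _⟩

/-- Two points of a closed dyadic cube of level `j` are within sup-distance `2⁻ʲ`. [folklore] -/
theorem dist_le_of_mem_closedCube {j : ℕ} {k : Fin m → ℕ} {x z : Fin m → ℝ}
    (hx : x ∈ closedCube j k) (hz : z ∈ closedCube j k) : dist x z ≤ 1 / 2 ^ j := by
  rw [dist_pi_le_iff (by positivity)]
  intro i
  rw [Real.dist_eq, abs_sub_le_iff]
  have hx1 := hx.1 i
  have hx2 := hx.2 i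
  have hz1 := hz.1 i
  have hz2 := hz.2 i
  have hd := cubeHi_sub_cubeLo j k i
  constructor <;> linarith

/-- Closed cubes are preconnected (they are convex). [folklore] -/
theorem isPreconnected_closedCube (j : ℕ) (k : Fin m → ℕ) : IsPreconnected (closedCube j k) := by
  have hconv : Convex ℝ (closedCube j k) := by
    rw [closedCube, ← pi_univ_Icc]
    exact convex_pi fun i _ => convex_Icc _ _
  exact hconv.isPreconnected

/-- Base-`L` digits: the cube index `k ∈ {0,…,L-1}ᵐ` with code `K < Lᵐ`, `kᵢ = ⌊K / Lⁱ⌋ mod L`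
(the inverse of `finFunctionFinEquiv`). Cube indices are coded by natural numbers so that the cube
counts below are values of primitive recursive functions. [folklore] -/
def digits (m L K : ℕ) : Fin m → ℕ := fun i => K / L ^ (i : ℕ) % L

/-- The digits of the code of `k : Fin m → Fin L` are the `k i`. [folklore] -/
theorem digits_finFunctionFinEquiv {L : ℕ} (k : Fin m → Fin L) :
    digits m L (finFunctionFinEquiv k : ℕ) = fun i => (k i : ℕ) := by
  funext i
  have h := finFunctionFinEquiv_symm_apply_val (finFunctionFinEquiv k) i
  rw [Equiv.symm_apply_apply] at h
  rw [digits, ← h]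

/-- Every index `k ∈ {0,…,L-1}ᵐ` is the digit vector of some code `K < Lᵐ`. [folklore] -/
theorem exists_digits_eq {L : ℕ} (k : Fin m → ℕ) (hk : ∀ i, k i < L) :
    ∃ K < L ^ m, digits m L K = k := by
  refine ⟨(finFunctionFinEquiv (fun i => (⟨k i, hk i⟩ : Fin L)) : ℕ), Fin.is_lt _, ?_⟩
  rw [digits_finFunctionFinEquiv]

/-- Codes `K < Lᵐ` with the same digits are equal. [folklore] -/
theorem digits_injOn (m L : ℕ) : Set.InjOn (digits m L) {K | K < L ^ m} := by
  intro K hK K' hK' h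
  have hk : ∀ K'' (hK'' : K'' < L ^ m), digits m L K'' =
      fun i => ((finFunctionFinEquiv.symm (⟨K'', hK''⟩ : Fin (L ^ m)) i : Fin L) : ℕ) := by
    intro K'' hK''
    funext i
    rw [finFunctionFinEquiv_symm_apply_val]
    rfl
  rw [hk K hK, hk K' hK'] at h
  have h2 : finFunctionFinEquiv.symm (⟨K, hK⟩ : Fin (L ^ m)) =
      finFunctionFinEquiv.symm (⟨K', hK'⟩ : Fin (L ^ m)) := by
    funext i
    exact Fin.ext (congr_fun h i)
  have h3 := finFunctionFinEquiv.symm.injective h2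
  exact congr_arg Fin.val h3

open Classical in
/-- Codes `K < Lᵐ` of the closed level-`j` cubes with index in `{0,…,L-1}ᵐ` contained in `s`
(Yoshinaga's inner Riemann sum `V_n`). [cite: Yoshinaga2008, §3.4] -/
def innerIdx (s : Set (Fin m → ℝ)) (j L : ℕ) : Finset ℕ :=
  (Finset.range (L ^ m)).filter fun K => closedCube j (digits m L K) ⊆ s

open Classical in
/-- Codes `K < Lᵐ` of the closed level-`j` cubes with index in `{0,…,L-1}ᵐ` meeting `s` (outer
Riemann sum). [folklore] -/
def outerIdx (s : Set (Fin m → ℝ)) (j L : ℕ) : Finset ℕ :=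
  (Finset.range (L ^ m)).filter fun K => (closedCube j (digits m L K) ∩ s).Nonempty

/-- Distinct codes below `Lᵐ` index disjoint half-open cubes. [folklore] -/
theorem pairwiseDisjoint_hoCube_digits (j L : ℕ) {S : Set ℕ} (hS : S ⊆ {K | K < L ^ m}) :
    S.PairwiseDisjoint fun K => hoCube j (digits m L K) := by
  intro K hK K' hK' hne
  rw [Function.onFun, Set.disjoint_left]
  intro x hx hx'
  exact hne (digits_injOn m L (hS hK) (hS hK') (eq_of_mem_hoCube hx hx'))

/-- Cubes contained in `s` meet `s`. [folklore] -/
theorem innerIdx_subset_outerIdx (s : Set (Fin m → ℝ)) (j L : ℕ) :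
    innerIdx s j L ⊆ outerIdx s j L := by
  classical
  intro K hK
  simp only [innerIdx, outerIdx, Finset.mem_filter] at hK ⊢
  have hmem : cubeLo j (digits m L K) ∈ closedCube j (digits m L K) :=
    ⟨le_rfl, cubeLo_le_cubeHi j _⟩
  exact ⟨hK.1, ⟨cubeLo j (digits m L K), hmem, hK.2 hmem⟩⟩

/-- The index finsets consist of codes below `Lᵐ`. [folklore] -/
theorem coe_outerIdx_subset (s : Set (Fin m → ℝ)) (j L : ℕ) :
    (↑(outerIdx s j L) : Set ℕ) ⊆ {K | K < L ^ m} := by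
  classical
  intro K hK
  have hK' : K ∈ outerIdx s j L := hK
  simp only [outerIdx, Finset.mem_filter, Finset.mem_range] at hK'
  exact hK'.1

/-- **Inner Riemann sum bound**: `#(inner cubes) · 2^{-jm} ≤ vol(s)`. [cite: Yoshinaga2008, §3.4] -/
theorem card_innerIdx_mul_le (s : Set (Fin m → ℝ)) (j L : ℕ) :
    ((innerIdx s j L).card : ENNReal) * ENNReal.ofReal ((1 / 2 ^ j) ^ m) ≤ volume s := by
  classical
  have hdisj : (↑(innerIdx s j L) : Set ℕ).PairwiseDisjoint fun K => hoCube j (digits m L K) :=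
    pairwiseDisjoint_hoCube_digits j L
      ((Finset.coe_subset.2 (innerIdx_subset_outerIdx s j L)).trans (coe_outerIdx_subset s j L))
  calc ((innerIdx s j L).card : ENNReal) * ENNReal.ofReal ((1 / 2 ^ j) ^ m)
        = ∑ K ∈ innerIdx s j L, volume (hoCube j (digits m L K)) := by
          simp [volume_hoCube, Finset.sum_const, nsmul_eq_mul]
    _ = volume (⋃ K ∈ innerIdx s j L, hoCube j (digits m L K)) :=
          (measure_biUnion_finset hdisj fun K _ => measurableSet_hoCube j _).symm
    _ ≤ volume s := by
          refine measure_mono fun x hx => ?_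
          rw [mem_iUnion₂] at hx
          obtain ⟨K, hK, hxK⟩ := hx
          have hK' : K ∈ innerIdx s j L := hK
          simp only [innerIdx, Finset.mem_filter] at hK'
          exact hK'.2 (hoCube_subset_closedCube j _ hxK)

/-- **Outer Riemann sum bound**: if `s ⊆ [0, L/2ʲ)ᵐ` then `vol(s) ≤ #(outer cubes) · 2^{-jm}`.
[folklore] -/
theorem le_card_outerIdx_mul (s : Set (Fin m → ℝ)) (j L : ℕ)
    (hs : ∀ x ∈ s, ∀ i, 0 ≤ x i ∧ x i * 2 ^ j < L) :
    volume s ≤ ((outerIdx s j L).card : ENNReal) * ENNReal.ofReal ((1 / 2 ^ j) ^ m) := by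
  classical
  have hcov : s ⊆ ⋃ K ∈ outerIdx s j L, hoCube j (digits m L K) := by
    intro x hx
    set k : Fin m → ℕ := fun i => ⌊x i * 2 ^ j⌋₊ with hk
    have hxk : x ∈ hoCube j k := mem_hoCube_floor (fun i => (hs x hx i).1)
    have hklt : ∀ i, k i < L := fun i =>
      (Nat.floor_lt (mul_nonneg (hs x hx i).1 (by positivity))).2 (hs x hx i).2
    obtain ⟨K, hKlt, hKk⟩ := exists_digits_eq k hklt
    refine mem_iUnion₂.2 ⟨K, ?_, by rw [hKk]; exact hxk⟩
    show K ∈ outerIdx s j L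
    simp only [outerIdx, Finset.mem_filter, Finset.mem_range]
    refine ⟨hKlt, ⟨x, ?_, hx⟩⟩
    rw [hKk]
    exact hoCube_subset_closedCube j k hxk
  calc volume s ≤ volume (⋃ K ∈ outerIdx s j L, hoCube j (digits m L K)) := measure_mono hcov
    _ ≤ ∑ K ∈ outerIdx s j L, volume (hoCube j (digits m L K)) := measure_biUnion_finset_le _ _
    _ = ((outerIdx s j L).card : ENNReal) * ENNReal.ofReal ((1 / 2 ^ j) ^ m) := by
          simp [volume_hoCube, Finset.sum_const, nsmul_eq_mul]

/-- **Gap bound**: the cubes meeting `s` but not contained in `s` meet the frontier of `s`, so lie in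
its closed `2⁻ʲ`-thickening; hence `(#outer - #inner) · 2^{-jm} ≤ vol(cthickening_{2⁻ʲ} ∂s)`
(cf. Yoshinaga 2008, §3.6, where the thickening of `∂D` controls `vol(D) - vol(V_n)`).
[cite: Yoshinaga2008, §3.6] -/
theorem card_sub_card_mul_le (s : Set (Fin m → ℝ)) (j L : ℕ) :
    (((outerIdx s j L).card - (innerIdx s j L).card : ℕ) : ENNReal) * ENNReal.ofReal ((1 / 2 ^ j) ^ m)
      ≤ volume (Metric.cthickening (1 / 2 ^ j) (frontier s)) := by
  classical
  have hcard : (outerIdx s j L \ innerIdx s j L).card =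
      (outerIdx s j L).card - (innerIdx s j L).card :=
    Finset.card_sdiff_of_subset (innerIdx_subset_outerIdx s j L)
  have hdisj : (↑(outerIdx s j L \ innerIdx s j L) : Set ℕ).PairwiseDisjoint
      fun K => hoCube j (digits m L K) :=
    pairwiseDisjoint_hoCube_digits j L
      ((Finset.coe_subset.2 Finset.sdiff_subset).trans (coe_outerIdx_subset s j L))
  rw [← hcard]
  calc (((outerIdx s j L \ innerIdx s j L).card : ℕ) : ENNReal) * ENNReal.ofReal ((1 / 2 ^ j) ^ m)
        = ∑ K ∈ outerIdx s j L \ innerIdx s j L, volume (hoCube j (digits m L K)) := by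
          simp [volume_hoCube, Finset.sum_const, nsmul_eq_mul]
    _ = volume (⋃ K ∈ outerIdx s j L \ innerIdx s j L, hoCube j (digits m L K)) :=
          (measure_biUnion_finset hdisj fun K _ => measurableSet_hoCube j _).symm
    _ ≤ volume (Metric.cthickening (1 / 2 ^ j) (frontier s)) := by
          refine measure_mono fun x hx => ?_
          rw [mem_iUnion₂] at hx
          obtain ⟨K, hK, hxK⟩ := hx
          have hK' : K ∈ outerIdx s j L \ innerIdx s j L := hK
          simp only [Finset.mem_sdiff, outerIdx, innerIdx, Finset.mem_filter, not_and] at hK'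
          obtain ⟨⟨hKidx, ⟨a, hac, has⟩⟩, hnot⟩ := hK'
          obtain ⟨b, hbc, hbs⟩ := not_subset.1 (hnot hKidx)
          obtain ⟨z, hzc, hzf⟩ :=
            exists_mem_frontier_of_isPreconnected (isPreconnected_closedCube j _) hac has hbc hbs
          exact Metric.mem_cthickening_of_dist_le x z _ _ hzf
            (dist_le_of_mem_closedCube (hoCube_subset_closedCube j _ hxK) hzc)

/-- For a bounded set with Lebesgue-null frontier, the volumes of the `2⁻ʲ`-thickenings of the
frontier tend to `0`. [folklore] -/
theorem tendsto_volume_cthickening_frontier {s : Set (Fin m → ℝ)} (hb : Bornology.IsBounded s)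
    (hfr : volume (frontier s) = 0) :
    Tendsto (fun j : ℕ => volume (Metric.cthickening (1 / 2 ^ j) (frontier s))) atTop (𝓝 0) := by
  have hfb : Bornology.IsBounded (frontier s) := hb.closure.subset frontier_subset_closure
  have hfin : ∃ R > (0 : ℝ), volume (Metric.cthickening R (frontier s)) ≠ ⊤ :=
    ⟨1, one_pos, hfb.cthickening.measure_lt_top.ne⟩
  have h := tendsto_measure_cthickening_of_isClosed hfin isClosed_frontier
  rw [hfr] at h
  have h2 : Tendsto (fun j : ℕ => (1 : ℝ) / 2 ^ j) atTop (𝓝 0) := by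
    have : (fun j : ℕ => (1 : ℝ) / 2 ^ j) = fun j => (1 / 2 : ℝ) ^ j := by
      funext j; rw [one_div_pow]
    rw [this]
    exact tendsto_pow_atTop_nhds_zero_of_lt_one (by norm_num) (by norm_num)
  exact h.comp h2

/-- **Convergence of the Riemann sums**: for a bounded set with null frontier the gap between the
outer and inner cube counts, times the cube volume, is eventually below any `ε > 0` (no rate is
claimed; Yoshinaga 2008, Lemma 29 gives a rate from the Minkowski content of `∂D`).
[cite: Yoshinaga2008, Lemma 29] -/
theorem exists_card_sub_card_mul_le {s : Set (Fin m → ℝ)} (hb : Bornology.IsBounded s)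
    (hfr : volume (frontier s) = 0) (L : ℕ → ℕ) {ε : ENNReal} (hε : 0 < ε) :
    ∃ j, (((outerIdx s j (L j)).card - (innerIdx s j (L j)).card : ℕ) : ENNReal) *
      ENNReal.ofReal ((1 / 2 ^ j) ^ m) ≤ ε := by
  have h := tendsto_volume_cthickening_frontier hb hfr
  obtain ⟨j, hj⟩ := (h.eventually (ge_mem_nhds hε)).exists
  exact ⟨j, (card_sub_card_mul_le s j (L j)).trans hj⟩

end Cubes

end Literature.NumberTheory.Transcendental
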